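import Summits.QuantumFields.BalabanUV.Beta.EriceRemainderEnclosureHistoryAutonomyComparisonAgeCompositionChainWiring
import Summits.QuantumFields.BalabanUV.Beta.EriceRemainderEnclosureHistoryAutonomyComparisonAgeCompositionStaticChainClosureAtPin

/-!
# EriceRemainderEnclosureHistoryAutonomyComparisonAgeCompositionChainWiringAtPin — (E80e) ROUTE (N), FIRST ORDER, END FOR THE FLOW MODULO MONO∕MONO′:
# the sandwich wiring (E80d) instantiated on the flow's first-order lone kernels, with the static chain BUILT at every pin and its CLOSURE supplied by
# (E80c) — **`flow_nonneg_of_mono`: for every box solution, MONO ∧ MONO′ ⟹ the first-order comparison surplus is non-negative**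

Cell `pub-balaban`, β-function sub-cell, BINDER row D4 «RemainderConst leaves for Bałaban's split» (`HOME/BINDER-OWNERS.md`; owner lineage `b2b-balaban-beta-an4`;
this file by co-owner #2 lineage `b2b-balaban-beta-d4-p2`, generation 71), β-FLOW TEAM duty (1), FREEZE (0) honoured (def-free; imports (E80d)
`…AgeCompositionChainWiring`, (E80c) `…StaticChainClosureAtPin` (hence (E75a)∕(E75b), (E76b), (E80b)); nothing restated).

HONEST FRAMING (page 1, verbatim and binding).  *"Discharging BetaPertH makes Bałaban's UV stability UNCONDITIONAL — a real constructive-QFT result; it is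
NOT the continuum limit and NOT the Clay problem."*  THIS FILE DISCHARGES NOTHING OF THE KIND.  Elementary real algebra over the cell's own binders `SeqBox`,
`MemFlow` and the hypothesis shape «isotone memory with floor dominated by a profile `L`», and abstract triangular read∕solution operators — hypotheses of
a census, not facts; the age profile of Bałaban's (1.22) limit functional is NOT PRINTED ([I] p. 298; GAPS G-t4-U2-1∕-2) and NOT asserted.  Row D4 class
UNCHANGED (critical-path width 0; instance 0∕1; D4 DISCHARGE NO DATE).  HONEST DEPENDENCY: continuum YM on T⁴ ⇐ BetaPertH ∧ nine spine estimates (0/9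
proved); BetaPertH ⇐ (D1) ∧ (D4) ∧ CAP+tail; G-an2-4 gates asym, D1 and NE2/3/4.

THE POINT (census sense (α); route (N) of README `g62/e71`; this station `HOME/b2b-balaban-beta-d4-p2/g71/e80/README.md`).  Route (N) END-TO-END read
(g62 §PS): first-order (E58′) for a finite profile ⟸ [the static chain closes at every pin] ∧ MONO ∧ MONO′.  (E80b)∕(E80c) proved the first bracket for every
box solution; (E80d) proved the implication in (E71b)'s abstract letters.  THIS FILE instantiates (E80d) ON THE FLOW: §1 the two existence lemmas the
instance needs and the READMEs took for granted — **`exists_zero_tailed_solution`**∕**`exists_solution_operator`** (zero-tailed solutions of a triangular system,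
downward from the horizon: (E71b)'s `SL`∕`SA` exist) and **`exists_static_chain`** (the chain's recursion DEFINES `ρ_i(n)`, `β_i(n,·)` downward from the oldest
age); §2 the dictionary between (E80c)'s STEP-indexed objects (young kernel `Ky^{(i')}`, older weights `E^{(i')}`, `k_{i'} = K−1−i'`) and (E80d)'s AGE-indexed lone
kernels `KL k n l = [1≤k<K][l<k](L_kh_{n+k}³∕2)Π_{t∈[n+1+l,n+k]}g_t` (= (E75a)'s `E` with `y := 0`): `young_kernel_eq`, `older_kernel_eq`, and the three sums
`young_load_eq` (x̃), `chain_load_eq` (Σθβ), `window_mass_eq` (Ω); §3 **`age_chain_closes`** — any age-indexed chain at any pin closes with window mass `< 1`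
((E80c) `flow_static_chain_closes_at_pin` + `flow_window_mass_lt_one_at_pin` through §2) — and the END **`flow_nonneg_of_mono`**: flow (`B` isotone, floor
`b > 0`, dominated by `L ≥ 0` on `range K`, `K ≥ 2`; box solution `h`; dampings `1∕(1+F) ≤ g ≤ 1`), the first-order operators of (E71b) for the flow's lone
kernels (`KA i = KL i + KA (i+1)`, `KA K = 0`, reads on the horizon `K`, zero-tailed solution operators), MONO_i and MONO′_i at every age ⟹ **the zero-tailed
solution of `ε = e − RA 1 ε` is `≥ 0` for every non-negative non-increasing zero-tailed excess `e`** — with NO chain among the hypotheses (built by §1, closed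
by (E80c)) and NO KEY (derived, (E80d)).  So at first order route (N) is reduced to MONO∕MONO′ ALONE, as a tree theorem about every box solution.  NOT CLAIMED:
MONO∕MONO′ (OPEN since g62; 0 violations numerically); that `ε ≥ 0` IS the first-order (E58′) (the identification of the linearised STEP system with these
kernels is README-level, g60/e70 §PS ∕ g62/e71); anything nonlinear; anything printed.

WHAT IS PROVED ([folklore]; 0 `def`, 0 sorry).  §1 **`exists_zero_tailed_solution`**, `exists_solution_operator`, **`exists_static_chain`**.  §2 `young_kernel_eq`,
`older_kernel_eq`, `young_load_eq`, `chain_load_eq`, `window_mass_eq`.  §3 **`age_chain_closes`**, **`flow_nonneg_of_mono`**.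
-/
noncomputable section
open Finset

namespace Summit.QuantumFields.BalabanUV.Beta.EriceRemainderEnclosureHistoryAutonomyComparisonAgeCompositionChainWiringAtPin

open Literature.MathematicalPhysics.QuantumFieldTheory.Balaban1983to89
open Literature.MathematicalPhysics.QuantumFieldTheory.Balaban1983to89.T4BetaStationary
open Literature.MathematicalPhysics.QuantumFieldTheory.Balaban1983to89.T4BetaFlowWellPosed
open Summit.QuantumFields.BalabanUV.Beta.EriceRemainderEnclosureHistoryAutonomyOrder (strictAnti_of_memFlow)
open Summit.QuantumFields.BalabanUV.Beta.EriceRemainderEnclosureHistoryAutonomyComparisonAgeCompositionIdentification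
open Summit.QuantumFields.BalabanUV.Beta.EriceRemainderEnclosureHistoryAutonomyComparisonAgeCompositionStaticChainClosureAtPin
open Summit.QuantumFields.BalabanUV.Beta.EriceRemainderEnclosureHistoryAutonomyComparisonAgeCompositionChainWiring

/-! ## §1 Zero-tailed solutions of a triangular system exist (so (E71b)'s solution operators `SL`, `SA` can be instantiated) -/

/-- **ZERO-TAILED SOLUTIONS EXIST.**  For any kernel `Kk` on the horizon `N` and any input `w` vanishing beyond `N` there is a sequence `t` vanishing
beyond `N` with `t m = w m − Σ_{l<N} Kk m l·t(m+1+l)` at every depth — built downward from the horizon, one depth at a time ((E71a) `sol_unique`: it is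
unique). [folklore] -/
theorem exists_zero_tailed_solution {N : ℕ} (Kk : ℕ → ℕ → ℝ) {w : ℕ → ℝ} (hw : ∀ m, N < m → w m = 0) :
    ∃ t : ℕ → ℝ, (∀ m, N < m → t m = 0) ∧ ∀ m, t m = w m - ∑ l ∈ range N, Kk m l * t (m + 1 + l) := by
  -- downward induction: after `d` steps the equation holds at every depth `≥ N + 1 − d`
  have key : ∀ d, ∃ t : ℕ → ℝ, (∀ m, N < m → t m = 0) ∧ ∀ m, N + 1 - d ≤ m → t m = w m - ∑ l ∈ range N, Kk m l * t (m + 1 + l) := by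
    intro d
    induction d with
    | zero =>
      refine ⟨fun _ => 0, fun _ _ => rfl, fun m hm => ?_⟩
      rw [hw m (by omega)]; simp
    | succ d ih =>
      obtain ⟨t, ht0, ht⟩ := ih
      by_cases hd : N < d
      · exact ⟨t, ht0, fun m hm => ht m (by omega)⟩
      · -- new depth `m₀ = N − d`
        set m₀ := N - d with hm₀
        refine ⟨Function.update t m₀ (w m₀ - ∑ l ∈ range N, Kk m₀ l * t (m₀ + 1 + l)), fun m hm => ?_, fun m hm => ?_⟩
        · rw [Function.update_of_ne (by omega)]; exact ht0 m hm
        · have hreads : ∀ m', m₀ ≤ m' → ∑ l ∈ range N, Kk m' l * Function.update t m₀ (w m₀ - ∑ l ∈ range N, Kk m₀ l * t (m₀ + 1 + l)) (m' + 1 + l)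
              = ∑ l ∈ range N, Kk m' l * t (m' + 1 + l) := fun m' hm' =>
            sum_congr rfl fun l _ => by rw [Function.update_of_ne (by omega)]
          rcases Nat.lt_or_ge m₀ m with hlt | hge
          · rw [Function.update_of_ne (by omega), hreads m hlt.le]; exact ht m (by omega)
          · have hm' : m = m₀ := by omega
            rw [hm', Function.update_self, hreads m₀ le_rfl]
  obtain ⟨t, ht0, ht⟩ := key (N + 1)
  exact ⟨t, ht0, fun m => ht m (by omega)⟩

/-- **A ZERO-TAILED SOLUTION OPERATOR EXISTS** (the shape of (E71b)'s hypotheses `hSL`∕`hSA`). [folklore] -/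
theorem exists_solution_operator {N : ℕ} (Kk : ℕ → ℕ → ℝ) :
    ∃ S : (ℕ → ℝ) → ℕ → ℝ, ∀ w : ℕ → ℝ, (∀ m, N < m → w m = 0) →
      (∀ m, N < m → S w m = 0) ∧ ∀ m, S w m = w m - ∑ l ∈ range N, Kk m l * S w (m + 1 + l) := by
  classical
  have h : ∀ w : ℕ → ℝ, ∃ t : ℕ → ℝ, (∀ m, N < m → w m = 0) →
      (∀ m, N < m → t m = 0) ∧ ∀ m, t m = w m - ∑ l ∈ range N, Kk m l * t (m + 1 + l) := by
    intro w
    by_cases hw : ∀ m, N < m → w m = 0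
    · obtain ⟨t, ht⟩ := exists_zero_tailed_solution Kk hw
      exact ⟨t, fun _ => ht⟩
    · exact ⟨fun _ => 0, fun h' => absurd h' hw⟩
  choose S hS using h
  exact ⟨S, hS⟩

/-- **A STATIC CHAIN EXISTS AT EVERY PIN** (the recursion of (E80d)∕`age_chain_closes` defines `ρ_i(n)`, `β_i(n,·)` downward from the oldest age; built
here by `Function.update`, one age at a time, so that the END theorem need not be handed a chain). [folklore] -/
theorem exists_static_chain (K : ℕ) (KL θ : ℕ → ℕ → ℕ → ℝ) :
    ∃ (ρ : ℕ → ℕ → ℝ) (β : ℕ → ℕ → ℕ → ℝ),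
      (∀ i n, 1 ≤ i → i ≤ K - 1 → ρ i n = (∑ l ∈ range K, KL i n l) * (1 + ∑ k ∈ Ioc i (K - 1), θ k n i * β (i + 1) n k) /
        (1 - ∑ k ∈ Ioc i (K - 1), ∑ l ∈ range i, KL k n l)) ∧
      (∀ i n, 1 ≤ i → i ≤ K - 1 → β i n i = ρ i n / (1 - ρ i n)) ∧
      (∀ i n k, 1 ≤ i → i < k → k ≤ K - 1 → β i n k = β (i + 1) n k / (1 - ρ i n)) := by
  -- after `d` steps the recursion holds at every age `i ≥ K − d`
  have key : ∀ d, ∃ (ρ : ℕ → ℕ → ℝ) (β : ℕ → ℕ → ℕ → ℝ),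
      (∀ i n, K - d ≤ i → 1 ≤ i → i ≤ K - 1 → ρ i n = (∑ l ∈ range K, KL i n l) * (1 + ∑ k ∈ Ioc i (K - 1), θ k n i * β (i + 1) n k) /
        (1 - ∑ k ∈ Ioc i (K - 1), ∑ l ∈ range i, KL k n l)) ∧
      (∀ i n, K - d ≤ i → 1 ≤ i → i ≤ K - 1 → β i n i = ρ i n / (1 - ρ i n)) ∧
      (∀ i n k, K - d ≤ i → 1 ≤ i → i < k → k ≤ K - 1 → β i n k = β (i + 1) n k / (1 - ρ i n)) := by
    intro d
    induction d with
    | zero => exact ⟨fun _ _ => 0, fun _ _ _ => 0, fun i n h1 _ h3 => by omega, fun i n h1 _ h3 => by omega, fun i n k h1 _ _ h4 => by omega⟩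
    | succ d ih =>
      obtain ⟨ρ, β, hρ, hβn, hβo⟩ := ih
      by_cases hd : K ≤ d
      · exact ⟨ρ, β, fun i n h1 => hρ i n (by omega), fun i n h1 => hβn i n (by omega), fun i n k h1 => hβo i n k (by omega)⟩
      · -- the new age `i₀ = K − d − 1`
        set i₀ := K - d - 1 with hi₀
        set ρ' : ℕ → ℕ → ℝ := Function.update ρ i₀ (fun n => (∑ l ∈ range K, KL i₀ n l) *
          (1 + ∑ k ∈ Ioc i₀ (K - 1), θ k n i₀ * β (i₀ + 1) n k) / (1 - ∑ k ∈ Ioc i₀ (K - 1), ∑ l ∈ range i₀, KL k n l)) with hρ'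
        set β' : ℕ → ℕ → ℕ → ℝ := Function.update β i₀ (fun n k => if k = i₀ then ρ' i₀ n / (1 - ρ' i₀ n)
          else β (i₀ + 1) n k / (1 - ρ' i₀ n)) with hβ'
        have hρ'old : ∀ i, i ≠ i₀ → ρ' i = ρ i := fun i hi => by rw [hρ', Function.update_of_ne hi]
        have hβ'old : ∀ i, i ≠ i₀ → β' i = β i := fun i hi => by rw [hβ', Function.update_of_ne hi]
        refine ⟨ρ', β', fun i n h1 h2 h3 => ?_, fun i n h1 h2 h3 => ?_, fun i n k h1 h2 h3 h4 => ?_⟩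
        · rcases Nat.lt_or_ge i₀ i with hlt | hge
          · rw [hρ'old i (by omega), hβ'old (i + 1) (by omega)]; exact hρ i n (by omega) h2 h3
          · have hi : i = i₀ := by omega
            subst hi
            rw [hβ'old (i₀ + 1) (by omega), hρ', Function.update_self]
        · rcases Nat.lt_or_ge i₀ i with hlt | hge
          · rw [hρ'old i (by omega), hβ'old i (by omega)]; exact hβn i n (by omega) h2 h3
          · have hi : i = i₀ := by omega
            subst hi
            conv_lhs => rw [hβ', Function.update_self]
            simp
        · rcases Nat.lt_or_ge i₀ i with hlt | hge
          · rw [hρ'old i (by omega), hβ'old i (by omega), hβ'old (i + 1) (by omega)]; exact hβo i n k (by omega) h2 h3 h4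
          · have hi : i = i₀ := by omega
            subst hi
            rw [hβ'old (i₀ + 1) (by omega)]
            conv_lhs => rw [hβ', Function.update_self]
            rw [if_neg (by omega)]
  obtain ⟨ρ, β, hρ, hβn, hβo⟩ := key K
  exact ⟨ρ, β, fun i n => hρ i n (by omega), fun i n => hβn i n (by omega), fun i n k => hβo i n k (by omega)⟩

/-! ## §2 The flow's lone kernels: the step-indexed objects of (E80c) versus the age-indexed objects of (E80d) -/

variable {B : (ℕ → ℝ) → ℝ} {γ b gIR : ℝ} {L : ℕ → ℝ} {K : ℕ} {h g : ℕ → ℝ} {KL θ : ℕ → ℕ → ℕ → ℝ}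

/-- The young kernel of (E80c) at step `i'` IS the lone kernel of age `K − 1 − i'`. [folklore] -/
theorem young_kernel_eq
    (hKL : ∀ k n l, KL k n l = if 0 < k ∧ k < K ∧ l < k then L k * h (n + k) ^ 3 / 2 * ∏ t ∈ Ico (n + 1 + l) (n + k + 1), g t else 0)
    (i' n l : ℕ) :
    (if l < K - 1 - i' then L (K - 1 - i') * h (n + (K - 1 - i')) ^ 3 / 2 * ∏ t ∈ Ico (n + 1 + l) (n + (K - 1 - i') + 1), g t else 0)
      = KL (K - 1 - i') n l := by
  rw [hKL]
  by_cases hl : l < K - 1 - i'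
  · rw [if_pos hl, if_pos ⟨by omega, by omega, hl⟩]
  · rw [if_neg hl, if_neg (fun h3 => hl h3.2.2)]

/-- The older read weights of (E80c) at step `i'`, on the ages older than `K − 1 − i'`, ARE the lone kernels. [folklore] -/
theorem older_kernel_eq
    (hKL : ∀ k n l, KL k n l = if 0 < k ∧ k < K ∧ l < k then L k * h (n + k) ^ 3 / 2 * ∏ t ∈ Ico (n + 1 + l) (n + k + 1), g t else 0)
    {i' kk : ℕ} (hkk : K - 1 - i' < kk) (n l : ℕ) :
    (if K - 1 - i' < kk ∧ kk < K ∧ l < kk then L kk * h (n + kk) ^ 3 / 2 * ∏ t ∈ Ico (n + 1 + l) (n + kk + 1), g t else 0) = KL kk n l := by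
  rw [hKL]
  by_cases hc : kk < K ∧ l < kk
  · rw [if_pos ⟨hkk, hc⟩, if_pos ⟨by omega, hc⟩]
  · rw [if_neg (fun h3 => hc h3.2), if_neg (fun h3 => hc h3.2)]

/-- (S1) the damped young load: `Σ_{l<K} Ky^{(i')}_{n,l} = Σ_{l<K} KL (K−1−i') n l`. [folklore] -/
theorem young_load_eq
    (hKL : ∀ k n l, KL k n l = if 0 < k ∧ k < K ∧ l < k then L k * h (n + k) ^ 3 / 2 * ∏ t ∈ Ico (n + 1 + l) (n + k + 1), g t else 0)
    (i' n : ℕ) :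
    ∑ l ∈ range K, (if l < K - 1 - i' then L (K - 1 - i') * h (n + (K - 1 - i')) ^ 3 / 2 * ∏ t ∈ Ico (n + 1 + l) (n + (K - 1 - i') + 1), g t else 0)
      = ∑ l ∈ range K, KL (K - 1 - i') n l :=
  sum_congr rfl fun l _ => young_kernel_eq hKL i' n l

/-- (S2) the chain load: the step-indexed sum over the earlier steps is the age-indexed sum over the older ages. [folklore] -/
theorem chain_load_eq {β : ℕ → ℕ → ℕ → ℝ} {i' : ℕ} (hi' : i' < K - 1) (n : ℕ) :
    ∑ l' ∈ range i', θ (K - 1 - l') n (K - 1 - i') * β (K - i') n (K - 1 - l')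
      = ∑ k ∈ Ioc (K - 1 - i') (K - 1), θ k n (K - 1 - i') * β (K - 1 - i' + 1) n k := by
  have h := sum_older_eq_sum_steps (K := K) (k := fun j => K - 1 - j) (fun _ _ => rfl) hi'
    (fun kk => θ kk n (K - 1 - i') * β (K - 1 - i' + 1) n kk)
  have hset : (range K).filter ((fun j => K - 1 - j) i' < ·) = Ioc (K - 1 - i') (K - 1) := by
    ext kk; simp only [mem_filter, mem_range, mem_Ioc]; omega
  rw [hset] at h
  rw [h, show K - i' = K - 1 - i' + 1 by omega]

/-- (S3) the old mass inside the young window: step-indexed double sum = age-indexed double sum. [folklore] -/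
theorem window_mass_eq
    (hKL : ∀ k n l, KL k n l = if 0 < k ∧ k < K ∧ l < k then L k * h (n + k) ^ 3 / 2 * ∏ t ∈ Ico (n + 1 + l) (n + k + 1), g t else 0)
    {i' : ℕ} (hi' : i' < K - 1) (n : ℕ) :
    ∑ kk ∈ range K, ∑ l ∈ (range K).filter (· < K - 1 - i'),
        (if K - 1 - i' < kk ∧ kk < K ∧ l < kk then L kk * h (n + kk) ^ 3 / 2 * ∏ t ∈ Ico (n + 1 + l) (n + kk + 1), g t else 0)
      = ∑ kk ∈ Ioc (K - 1 - i') (K - 1), ∑ l ∈ range (K - 1 - i'), KL kk n l := by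
  have hfl : (range K).filter (· < K - 1 - i') = range (K - 1 - i') := by
    ext l; simp only [mem_filter, mem_range]; omega
  rw [hfl, ← sum_filter_add_sum_filter_not (range K) (fun kk => K - 1 - i' < kk)]
  have hzero : ∑ kk ∈ (range K).filter (fun kk => ¬ K - 1 - i' < kk), ∑ l ∈ range (K - 1 - i'),
      (if K - 1 - i' < kk ∧ kk < K ∧ l < kk then L kk * h (n + kk) ^ 3 / 2 * ∏ t ∈ Ico (n + 1 + l) (n + kk + 1), g t else 0) = 0 :=
    sum_eq_zero fun kk hkk => sum_eq_zero fun l _ => by rw [mem_filter] at hkk; rw [if_neg (fun h3 => hkk.2 h3.1)]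
  rw [hzero, add_zero]
  have hset : (range K).filter (fun kk => K - 1 - i' < kk) = Ioc (K - 1 - i') (K - 1) := by
    ext kk; simp only [mem_filter, mem_range, mem_Ioc]; omega
  rw [hset]
  exact sum_congr rfl fun kk hkk => sum_congr rfl fun l _ => older_kernel_eq hKL (mem_Ioc.mp hkk).1 n l

/-! ## §3 THE STATIC CHAIN OF THE FLOW CLOSES IN AGE INDEXING, and ROUTE (N)'s FIRST-ORDER END FOR THE FLOW MODULO MONO∕MONO′ -/

/-- **THE AGE-INDEXED CHAIN CLOSES AT EVERY PIN, WITH WINDOW MASS BELOW ONE.**  Flow: `B` isotone with floor `b > 0` dominated by `L ≥ 0` on `range K`,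
box solution `h` from the pin `gIR`, dampings `1∕(1+F) ≤ g ≤ 1`; lone kernels `KL k n l = [1≤k<K][l<k]·(L_kh_{n+k}³∕2)·Π_{t∈[n+1+l,n+k]}g_t`, defects
`θ̂_k(n;l)`.  A static chain in AGE indexing at every pin `n` — `ρ_i(n) = x̃_i(n)(1 + Σ_{k∈(i,K−1]} θ̂_k(n;i)β_{i+1}(n,k))∕(1 − Σ_{k∈(i,K−1]}Σ_{l<i}KL k n l)`,
`β_i(n,i) = ρ_i(n)∕(1−ρ_i(n))`, `β_i(n,k) = β_{i+1}(n,k)∕(1−ρ_i(n))` — closes: `ρ_i(n) < 1` and `Σ_{k∈(i,K−1]}Σ_{l<i}KL k n l < 1` for `1 ≤ i ≤ K − 1`.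
((E80c) `flow_static_chain_closes_at_pin`∕`flow_window_mass_lt_one_at_pin` at the pin `n` for the step-indexed chain `ρ'_{i'} = ρ_{K−1−i'}(n)`,
`b'_{j,l'} = β_{K−j}(n, K−1−l')`, through §2's three identities.) [folklore] -/
theorem age_chain_closes (hmono : ∀ u v : ℕ → ℝ, SeqBox γ u → SeqBox γ v → (∀ j, u j ≤ v j) → B u ≤ B v)
    (hL : ∀ k, 0 ≤ L k) (hb : 0 < b) (hlo : ∀ u, SeqBox γ u → b ≤ B u) (hdom : ∀ u, SeqBox γ u → ∑ k ∈ range K, L k * u k ≤ B u)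
    (hh : SeqBox γ h) (hf : MemFlow B gIR h)
    (hg : ∀ t, 0 < g t ∧ g t ≤ 1) (hgF : ∀ t, 1 / (1 + ∑ k ∈ range K, L k * h (t + k) ^ 3 / 2) ≤ g t)
    (hKL : ∀ k n l, KL k n l = if 0 < k ∧ k < K ∧ l < k then L k * h (n + k) ^ 3 / 2 * ∏ t ∈ Ico (n + 1 + l) (n + k + 1), g t else 0)
    (hθ : ∀ k n l, θ k n l = 1 - (h (n + k + l) / h (n + k)) ^ 3 * ∏ t ∈ Ico (n + k + 1) (n + k + l + 1), g t)
    {ρ : ℕ → ℕ → ℝ} {β : ℕ → ℕ → ℕ → ℝ}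
    (hρ : ∀ i n, 1 ≤ i → i ≤ K - 1 → ρ i n = (∑ l ∈ range K, KL i n l) * (1 + ∑ k ∈ Ioc i (K - 1), θ k n i * β (i + 1) n k) /
      (1 - ∑ k ∈ Ioc i (K - 1), ∑ l ∈ range i, KL k n l))
    (hβnew : ∀ i n, 1 ≤ i → i ≤ K - 1 → β i n i = ρ i n / (1 - ρ i n))
    (hβold : ∀ i n k, 1 ≤ i → i < k → k ≤ K - 1 → β i n k = β (i + 1) n k / (1 - ρ i n))
    (n : ℕ) {i : ℕ} (hi1 : 1 ≤ i) (hiK : i ≤ K - 1) :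
    ρ i n < 1 ∧ ∑ k ∈ Ioc i (K - 1), ∑ l ∈ range i, KL k n l < 1 := by
  -- the step-indexed chain at the pin `n`
  have hρ' : ∀ i', i' < K - 1 → ρ (K - 1 - i') n =
      (∑ l ∈ range K, (if l < K - 1 - i' then L (K - 1 - i') * h (n + (K - 1 - i')) ^ 3 / 2 *
          ∏ t ∈ Ico (n + 1 + l) (n + (K - 1 - i') + 1), g t else 0)) *
        (1 + ∑ l' ∈ range i', θ (K - 1 - l') n (K - 1 - i') * β (K - i') n (K - 1 - l')) /
        (1 - ∑ kk ∈ range K, ∑ l ∈ (range K).filter (· < K - 1 - i'),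
          (if K - 1 - i' < kk ∧ kk < K ∧ l < kk then L kk * h (n + kk) ^ 3 / 2 * ∏ t ∈ Ico (n + 1 + l) (n + kk + 1), g t else 0)) := by
    intro i' hi'
    rw [young_load_eq hKL i' n, chain_load_eq hi', window_mass_eq hKL hi', hρ (K - 1 - i') n (by omega) (by omega)]
  have hnew' : ∀ i', i' < K - 1 → β (K - (i' + 1)) n (K - 1 - i') = ρ (K - 1 - i') n / (1 - ρ (K - 1 - i') n) := by
    intro i' hi'
    rw [show K - (i' + 1) = K - 1 - i' by omega]
    exact hβnew (K - 1 - i') n (by omega) (by omega)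
  have hold' : ∀ i' l', l' < i' → i' < K - 1 → β (K - (i' + 1)) n (K - 1 - l') = β (K - i') n (K - 1 - l') / (1 - ρ (K - 1 - i') n) := by
    intro i' l' hl' hi'
    rw [show K - (i' + 1) = K - 1 - i' by omega, show K - i' = K - 1 - i' + 1 by omega]
    exact hβold (K - 1 - i') n (K - 1 - l') (by omega) (by omega) (by omega)
  have hclose := flow_static_chain_closes_at_pin (k := fun j => K - 1 - j) (ρ := fun i' => ρ (K - 1 - i') n)
    (b' := fun j l' => β (K - j) n (K - 1 - l'))
    (Ky := fun i' mm l => if l < K - 1 - i' then L (K - 1 - i') * h (mm + (K - 1 - i')) ^ 3 / 2 *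
      ∏ t ∈ Ico (mm + 1 + l) (mm + (K - 1 - i') + 1), g t else 0)
    (θd := θ)
    (E := fun i' kk mm l => if K - 1 - i' < kk ∧ kk < K ∧ l < kk then L kk * h (mm + kk) ^ 3 / 2 * ∏ t ∈ Ico (mm + 1 + l) (mm + kk + 1), g t else 0)
    hmono hL hb hlo hdom hh hf hg hgF n (fun _ _ => rfl) (fun _ _ _ => rfl) (fun _ _ _ _ => rfl) hθ hρ' hnew' hold'
  have hΩ := flow_window_mass_lt_one_at_pin (k := fun j => K - 1 - j) (ρ := fun i' => ρ (K - 1 - i') n)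
    (b' := fun j l' => β (K - j) n (K - 1 - l'))
    (Ky := fun i' mm l => if l < K - 1 - i' then L (K - 1 - i') * h (mm + (K - 1 - i')) ^ 3 / 2 *
      ∏ t ∈ Ico (mm + 1 + l) (mm + (K - 1 - i') + 1), g t else 0)
    (θd := θ)
    (E := fun i' kk mm l => if K - 1 - i' < kk ∧ kk < K ∧ l < kk then L kk * h (mm + kk) ^ 3 / 2 * ∏ t ∈ Ico (mm + 1 + l) (mm + kk + 1), g t else 0)
    hmono hL hb hlo hdom hh hf hg hgF n (fun _ _ => rfl) (fun _ _ _ => rfl) (fun _ _ _ _ => rfl) hθ hρ' hnew' hold'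
  have h1 := (hclose (K - 1 - i) (by omega)).2
  have h2 := hΩ (K - 1 - i) (by omega)
  rw [window_mass_eq hKL (by omega : K - 1 - i < K - 1)] at h2
  rw [show K - 1 - (K - 1 - i) = i by omega] at h1 h2
  exact ⟨h1, h2⟩

/-- **ROUTE (N), FIRST ORDER, END FOR THE FLOW — MODULO MONO∕MONO′.**  Flow as in `age_chain_closes` (`K ≥ 2`); the first-order objects of (E71b) FOR THE
FLOW: lone kernels `KL` (as displayed), aggregates `KA i = KL i + KA (i+1)`, `KA K = 0`, reads `RL`, `RA` on the horizon `K`, zero-tailed solution operators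
`SL`, `SA` (they exist: §1 `exists_solution_operator`); MONO_i and MONO′_i at every age — and NOTHING about any chain: the static chain at every pin is
BUILT inside (§1 `exists_static_chain`) and CLOSES by `age_chain_closes` ((E80c)).  THEN the zero-tailed solution `ε` of the full first-order system `ε = e − RA 1 ε` with a
non-negative non-increasing zero-tailed excess `e` is NON-NEGATIVE at every depth.  ((E80d) `nonneg_of_chain_closes` with `y = id`, `N = K`, `n = K−1`;
`hKL`∕`hKLN`∕`hpers`∕`hθ0`∕`hθmono` = (E75a) `weight_nonneg`∕`weight_eq_zero_of_horizon`∕`persistence`∕`defect_nonneg`∕`defect_mono` with `y := 0`;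
`hclose`∕`hΩ1` = `age_chain_closes`.)  The static half of route (N) is thereby ENTIRELY a theorem about box solutions; MONO∕MONO′ remain hypotheses. [folklore] -/
theorem flow_nonneg_of_mono (hmono : ∀ u v : ℕ → ℝ, SeqBox γ u → SeqBox γ v → (∀ j, u j ≤ v j) → B u ≤ B v)
    (hL : ∀ k, 0 ≤ L k) (hb : 0 < b) (hlo : ∀ u, SeqBox γ u → b ≤ B u) (hdom : ∀ u, SeqBox γ u → ∑ k ∈ range K, L k * u k ≤ B u)
    (hh : SeqBox γ h) (hf : MemFlow B gIR h)
    (hg : ∀ t, 0 < g t ∧ g t ≤ 1) (hgF : ∀ t, 1 / (1 + ∑ k ∈ range K, L k * h (t + k) ^ 3 / 2) ≤ g t) (hK : 2 ≤ K)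
    (hKL : ∀ k n l, KL k n l = if 0 < k ∧ k < K ∧ l < k then L k * h (n + k) ^ 3 / 2 * ∏ t ∈ Ico (n + 1 + l) (n + k + 1), g t else 0)
    (hθ : ∀ k n l, θ k n l = 1 - (h (n + k + l) / h (n + k)) ^ 3 * ∏ t ∈ Ico (n + k + 1) (n + k + l + 1), g t)
    {KA : ℕ → ℕ → ℕ → ℝ} {RL RA SL SA : ℕ → (ℕ → ℝ) → ℕ → ℝ}
    (hRL : ∀ i v m, RL i v m = ∑ l ∈ range K, KL i m l * v (m + 1 + l))
    (hRA : ∀ i v m, RA i v m = ∑ l ∈ range K, KA i m l * v (m + 1 + l))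
    (hKA : ∀ i m l, KA i m l = KL i m l + KA (i + 1) m l) (hKAtop : ∀ m l, KA K m l = 0)
    (hSL : ∀ i (w : ℕ → ℝ), (∀ m, K < m → w m = 0) → (∀ m, K < m → SL i w m = 0) ∧ ∀ m, SL i w m = w m - RL i (SL i w) m)
    (hSA : ∀ i (w : ℕ → ℝ), (∀ m, K < m → w m = 0) → (∀ m, K < m → SA i w m = 0) ∧ ∀ m, SA i w m = w m - RA i (SA i w) m)
    (hMONO : ∀ i, 1 ≤ i → i ≤ K - 1 → ∀ w : ℕ → ℝ, (∀ m, 0 ≤ w m) → (∀ m, w (m + 1) ≤ w m) → (∀ m, K < m → w m = 0) →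
      (∀ m, 0 ≤ RA (i + 1) (RL i (SL i (SA (i + 1) w))) m) ∧
      (∀ m, RA (i + 1) (RL i (SL i (SA (i + 1) w))) (m + 1) ≤ RA (i + 1) (RL i (SL i (SA (i + 1) w))) m))
    (hMONO' : ∀ i, 1 ≤ i → i ≤ K - 1 → ∀ w : ℕ → ℝ, (∀ m, 0 ≤ w m) → (∀ m, w (m + 1) ≤ w m) → (∀ m, K < m → w m = 0) →
      ∀ m, RL i (SA i w) (m + 1) ≤ RL i (SA i w) m)
    {e ε : ℕ → ℝ} (he0 : ∀ m, 0 ≤ e m) (hea : ∀ m, e (m + 1) ≤ e m) (het : ∀ m, K < m → e m = 0)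
    (hεt : ∀ m, K < m → ε m = 0) (hεrec : ∀ m, ε m = e m - RA 1 ε m) : ∀ m, 0 ≤ ε m := by
  have hh0 : ∀ n, 0 < h n := fun n => (hh n).1
  have hanti := (strictAnti_of_memFlow hb hlo hh hf).antitone
  obtain ⟨ρ, β, hρ, hβnew, hβold⟩ := exists_static_chain K KL θ
  have hac := fun n i (hi1 : 1 ≤ i) (hiK : i ≤ K - 1) =>
    age_chain_closes hmono hL hb hlo hdom hh hf hg hgF hKL hθ hρ hβnew hβold n hi1 hiK
  exact nonneg_of_chain_closes (N := K) (n := K - 1) (y := fun i => i) (KL := KL) (θ := θ)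
    (weight_nonneg hL hh0 hg hKL) (weight_eq_zero_of_horizon hKL)
    (fun i m l hl => by rw [hKL, if_neg (fun h3 => by omega)])
    hRL hRA hKA (fun m l => by rw [Nat.sub_add_cancel (by omega : 1 ≤ K)]; exact hKAtop m l) hSL hSA
    (fun i hi1 hiK => ⟨hi1, by omega⟩)
    (defect_nonneg hh0 hanti hg hθ) (persistence hL hh0 hg hKL hθ) (fun k m l l' hll' => defect_mono hh0 hanti hg hθ k m hll')
    hρ hβnew hβold (fun i m hi1 hiK => (hac m i hi1 hiK).2) (fun i m hi1 hiK => (hac m i hi1 hiK).1) hMONO hMONO' he0 hea het hεt hεrec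

end Summit.QuantumFields.BalabanUV.Beta.EriceRemainderEnclosureHistoryAutonomyComparisonAgeCompositionChainWiringAtPin

end
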